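/-
Copyright (c) 2026. All rights reserved.
Released under Apache 2.0 license as described in the file LICENSE.
Authors: abc-iut cell — seat abc-iut-w4-d071 (wave 4, gen 4; T54 binder board, obstruction pricing the
residual «hUρ» of the hcof-free route at edgeless data).
-/
import Literature.AnabelianGeometry.SemiGraphs.SubgroupPresentationArithAction
import Literature.AnabelianGeometry.SemiGraphs.ArithTemperedGroupOfOuterAction
import Literature.AnabelianGeometry.SemiGraphs.TemperedPiTopologicallyFinitelyGenerated
import HarnessLib

/-!
# [SemiAnbd] Thm 5.4 (i) p. 66, producer T54-B: the residual «hUρ : U_∞ ≤ ker ρ» FORCES `ρ = 1`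
# at EDGELESS data (kernel obstruction; proof-only)

Mochizuki, *Semi-graphs of anabelioids*, Publ. RIMS **42** (2006), §5: Def 5.1 (i) p. 62 (an
arithmetic semi-graph of anabelioids: `ρ_𝒢 : π̂₁(A) → Aut(𝒢)` is an ARBITRARY continuous action —
no faithfulness), Thm 5.4 (i)(ii) p. 66, Example 5.6 p. 67 (pointed stable curves; a curve with SMOOTH
special fibre has the one-vertex edgeless dual semi-graph). [cite: MochizukiSemiAnbd2006, Thm 5.4 (i) p.66]

PROOF-ONLY file (abc-iut cell, layer L3, row T54-B = GAP-LEDGER G-w4d085-1 and its sharpening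
D-G-w4d085-1 / STATUS 10:49:08Z; seat abc-iut-w4-d071 gen 4; no `def`, no named fact, no instance).
abc-iut-w4-d085's hcof-free route to the capstone of Thm 5.4 (i) at the outer model
`π₁^temp(𝒢) ⋊^out Π_A` (`ArithBranchPairAugModKernel`, `ArithLevelCofinalityOuterAction`,
`ArithLevelKernelBaseAction`) leaves ONE residual binder that is not a hypothesis of print:
«hUρ» — every `a ∈ Π_A` admitting at EVERY finite coset level `K` a lift to
`E := π₁^temp(𝒢) ⋊^out Π_A` acting trivially on the level-`K` coset semi-graph lies in `ker ρ`,
i.e. `U_∞ := ⋂_K aug (ker (arithAct K)) ≤ ker ρ`.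

This file PRICES that binder in the kernel: it is not merely "not yet derived" but FAILS at
print-admissible data.  For a presentation `P` of `Γ` over a semi-graph `𝔾` with ONE vertex `w`, NO
edges and `H_w = Γ` (the shape of `π₁^temp` of a one-vertex edgeless graph of anabelioids — the
tempered fundamental group IS the vertex group; [SemiAnbd] Ex 5.6 with smooth special fibre):

* `cosetGraph_vertex_subsingleton`, `cosetGraph_edge_isEmpty`, `cosetGraph_branch_isEmpty` — every
  coset level `P.cosetGraph K` is the one-vertex edgeless semi-graph (`H_w \ Γ / K` is a point);
* `arithAct_eq_one_of_edgeless`, `ker_arithAct_eq_top_of_edgeless` — hence EVERY element of `E` acts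
  trivially on EVERY coset level: `ker (arithAct K) = E`;
* `map_ker_arithAct_eq_top_of_edgeless` — at the outer model, `aug (ker (arithAct K)) = Π_A` for every
  level (`aug` is onto, `outerSemidirectProductSnd_surjective`), so `U_∞ = Π_A`;
* `rho_eq_one_of_hUρ_of_edgeless` — consequently «hUρ» holds at such data IF AND ONLY IF `ρ = 1`
  (`hUρ_iff_rho_eq_one_of_edgeless`);
* `GaloisLevelData.piPresentation_H_eq_top_of_edgeless` — the hypothesis `H_w = Γ` HOLDS at the cell's
  coset-tower presentations `D.piPresentation h𝒢 T R` of `π₁^temp(𝒢)` (ANY `GaloisLevelData D`: the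
  canonical tower `𝒢.galoisLevelData h36` of the capstones, abc-iut-L3-t9's characteristic tower
  `ofCharCores`, …) whenever `𝒢` is one-vertex edgeless: `H_w` is closed (compact vertex group) and,
  there being no branch elements, generates `π₁^temp(𝒢)` topologically
  (abc-iut-w4-d071 gen 3's `GaloisLevelData.eq_top_of_isClosed`).  So the obstruction applies verbatim to
  the residual of the capstone/corollary at edgeless `𝒢`.

Such `𝒢` are admissible data for the capstones: abc-iut-f-177's
`ProfiniteSemiGraph.OneVertexEdgeless.thm37Hypotheses` (`OneVertexEdgelessHypotheses.lean`) supplies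
`Thm37Hypotheses` for EVERY one-vertex edgeless presentation over slim vertex groups with level families.
Whereas Thm 5.4 (i)(ii) hold at such data for EVERY `ρ` (the only verticial subgroup is `E` itself;
"totally arithmetically estranged", "no branch switching" and the branch-pair stabiliser clause are
vacuous without edges): e.g. `Π_v := ℤ_p`, `Π_A := ℤ_p^×` acting by multiplication (a non-trivial
outer action).  READING for the binder board / CERT-L3: via the hcof-free route (as via `hfaith-arith`,
which implies `ker ρ ⊓ ker baseAct = ⊥`) SemiAnbd:Thm5.4(i) is discharged on the SUB-CLASS of arithmetic
semi-graphs whose finite coset-level actions detect the outer action — a class EXCLUDING the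
good-reduction case with non-trivial Galois outer action; and «hUρ» cannot follow from normal
terminality of `π₁^temp(𝒢)` in its level completion alone (trivially true here), only through
edges/cusps by which the level graphs see `Out(Π_v)`.

Nothing here refutes or asserts [SemiAnbd] Thm 5.4 (a published theorem) — it constrains OUR residual
binder; typed ≠ proved; no side taken on [IUTchIII] Cor 3.12.
-/

namespace Literature.AnabelianGeometry.SemiGraphs

namespace SemiGraph.SubgroupPresentation

open CategoryTheory

universe u v

variable {𝔾 : SemiGraph.{u}} {Γ : Type u} [Group Γ] (P : SubgroupPresentation 𝔾 Γ)

/-- Over a one-vertex semi-graph with `H_w = Γ`, every coset level has exactly one vertex: the double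
coset space `H_w \ Γ / K = Γ \ Γ / K` is a point. [cite: MochizukiSemiAnbd2006, Thm 5.4 (i) p.66] -/
theorem cosetGraph_vertex_subsingleton [Subsingleton 𝔾.Vertex] (hH : ∀ w, P.H w = ⊤)
    (K : Subgroup Γ) : Subsingleton (P.cosetGraph K).Vertex := by
  refine ⟨fun x y => ?_⟩
  obtain ⟨w, a, rfl⟩ := P.vMk_surjective K x
  obtain ⟨w', b, rfl⟩ := P.vMk_surjective K y
  obtain rfl : w = w' := Subsingleton.elim _ _
  change (⟨w, DoubleCoset.mk (P.H w) K a⟩ : (P.cosetGraph K).Vertex) = ⟨w, DoubleCoset.mk (P.H w) K b⟩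
  congr 1
  exact (DoubleCoset.eq (P.H w) K a b).mpr
    ⟨b * a⁻¹, by rw [hH]; exact Subgroup.mem_top _, 1, K.one_mem, by group⟩

/-- Over an edgeless semi-graph every coset level is edgeless. [cite: MochizukiSemiAnbd2006, Thm 5.4 (i) p.66] -/
theorem cosetGraph_edge_isEmpty [IsEmpty 𝔾.Edge] (K : Subgroup Γ) : IsEmpty (P.cosetGraph K).Edge :=
  ⟨fun x => isEmptyElim (α := 𝔾.Edge) x.1⟩

/-- Over an edgeless semi-graph every coset level has no branches.
[cite: MochizukiSemiAnbd2006, Thm 5.4 (i) p.66] -/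
theorem cosetGraph_branch_isEmpty [IsEmpty 𝔾.Edge] (K : Subgroup Γ) :
    IsEmpty (P.cosetGraph K).Branch :=
  ⟨fun x => isEmptyElim (α := 𝔾.Edge) x.1.2.1⟩

variable {E : Type v} [Group E] {Φ : E →* MulAut Γ} {σ : E →* Aut 𝔾} (hP : P.IsArithCompatible Φ σ)

/-- **At one-vertex edgeless data (`H_w = Γ`) every element of `E` acts TRIVIALLY on every coset
level**: the level-`K` coset semi-graph is the one-vertex edgeless semi-graph, whose only automorphism
is the identity. [cite: MochizukiSemiAnbd2006, Thm 5.4 (i) p.66] -/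
theorem arithAct_eq_one_of_edgeless [Subsingleton 𝔾.Vertex] [IsEmpty 𝔾.Edge] (hH : ∀ w, P.H w = ⊤)
    (K : Subgroup Γ) (hK : ∀ (e : E) (x : Γ), x ∈ K → Φ e x ∈ K) (e : E) :
    P.arithAct hP K hK e = 1 := by
  haveI := P.cosetGraph_vertex_subsingleton hH K
  haveI := P.cosetGraph_edge_isEmpty K
  haveI := P.cosetGraph_branch_isEmpty K
  ext : 1
  exact SemiGraph.hom_ext _ _ (funext fun x => Subsingleton.elim _ _)
    (funext fun x => isEmptyElim x) (funext fun x => isEmptyElim x)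

/-- Hence the kernel of every level action is ALL of `E`. [cite: MochizukiSemiAnbd2006, Thm 5.4 (i) p.66] -/
theorem ker_arithAct_eq_top_of_edgeless [Subsingleton 𝔾.Vertex] [IsEmpty 𝔾.Edge]
    (hH : ∀ w, P.H w = ⊤) (K : Subgroup Γ) (hK : ∀ (e : E) (x : Γ), x ∈ K → Φ e x ∈ K) :
    (P.arithAct hP K hK).ker = ⊤ :=
  top_unique fun e _ => (MonoidHom.mem_ker).mpr (P.arithAct_eq_one_of_edgeless hP hH K hK e)

end SemiGraph.SubgroupPresentation

namespace ProfiniteSemiGraph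

open CategoryTheory Topology
open Literature.AnabelianGeometry.EtaleTheta

universe w

variable {𝒢 : ProfiniteSemiGraph.{w}} (c : TemperedPiChart 𝒢)
  {PA : Type w} [Group PA] (ρ : PA →* TopOut c.G) (baseAct : PA →* Aut 𝒢.graph)
  (P : SemiGraph.SubgroupPresentation 𝒢.graph c.G)
  (hP : P.IsArithCompatible
    (((contMulAut c.G).subtype.comp (MonoidHom.fst (contMulAut c.G) PA)).comp
      (outerSemidirectProduct ρ).subtype)
    (baseAct.comp (outerSemidirectProductSnd ρ)))

/-- **At the outer model over one-vertex edgeless data, `aug (ker (arithAct K)) = Π_A` at EVERY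
level** (`aug : π₁^temp(𝒢) ⋊^out Π_A → Π_A` is onto): so `U_∞ = Π_A`.
[cite: MochizukiSemiAnbd2006, Thm 5.4 (i) p.66] -/
theorem map_ker_arithAct_eq_top_of_edgeless [Subsingleton 𝒢.graph.Vertex] [IsEmpty 𝒢.graph.Edge]
    (hH : ∀ w, P.H w = ⊤) (L : Subgroup c.G)
    (hL : ∀ (e : outerSemidirectProduct ρ) (x : c.G), x ∈ L →
      (((contMulAut c.G).subtype.comp (MonoidHom.fst (contMulAut c.G) PA)).comp
        (outerSemidirectProduct ρ).subtype) e x ∈ L) :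
    ((P.arithAct hP L hL).ker).map (outerSemidirectProductSnd ρ) = ⊤ := by
  rw [P.ker_arithAct_eq_top_of_edgeless hP hH L hL, ← MonoidHom.range_eq_map]
  exact MonoidHom.range_eq_top.mpr (outerSemidirectProductSnd_surjective ρ)

/-- **The residual «hUρ» of the hcof-free route FORCES `ρ = 1` at one-vertex edgeless data**: there
`U_∞ = Π_A`, so "every `a ∈ U_∞` lies in `ker ρ`" says that the outer action is trivial — whereas
print's Thm 5.4 allows, and holds for, an arbitrary continuous `ρ` (e.g. the Galois outer action on
`Π_v` for a curve with smooth special fibre).  The binder therefore restricts the capstone to a proper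
sub-class of print's data. [cite: MochizukiSemiAnbd2006, Thm 5.4 (i) p.66] -/
theorem rho_eq_one_of_hUρ_of_edgeless [Subsingleton 𝒢.graph.Vertex] [IsEmpty 𝒢.graph.Edge]
    (hH : ∀ w, P.H w = ⊤) {J : Type*} (L : J → Subgroup c.G)
    (hL : ∀ (j : J) (e : outerSemidirectProduct ρ) (x : c.G), x ∈ L j →
      (((contMulAut c.G).subtype.comp (MonoidHom.fst (contMulAut c.G) PA)).comp
        (outerSemidirectProduct ρ).subtype) e x ∈ L j)
    (hUρ : ∀ a : PA,
      (∀ j, a ∈ ((P.arithAct hP (L j) (hL j)).ker).map (outerSemidirectProductSnd ρ)) → a ∈ ρ.ker) :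
    ρ = 1 := by
  refine MonoidHom.ext fun a => (MonoidHom.mem_ker).mp (hUρ a fun j => ?_)
  rw [map_ker_arithAct_eq_top_of_edgeless c ρ baseAct P hP hH (L j) (hL j)]
  exact Subgroup.mem_top a

/-- **«hUρ» at one-vertex edgeless data holds iff `ρ = 1`** (the converse direction being trivial:
`ker 1 = Π_A`). [cite: MochizukiSemiAnbd2006, Thm 5.4 (i) p.66] -/
theorem hUρ_iff_rho_eq_one_of_edgeless [Subsingleton 𝒢.graph.Vertex] [IsEmpty 𝒢.graph.Edge]
    (hH : ∀ w, P.H w = ⊤) {J : Type*} (L : J → Subgroup c.G)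
    (hL : ∀ (j : J) (e : outerSemidirectProduct ρ) (x : c.G), x ∈ L j →
      (((contMulAut c.G).subtype.comp (MonoidHom.fst (contMulAut c.G) PA)).comp
        (outerSemidirectProduct ρ).subtype) e x ∈ L j) :
    (∀ a : PA,
      (∀ j, a ∈ ((P.arithAct hP (L j) (hL j)).ker).map (outerSemidirectProductSnd ρ)) → a ∈ ρ.ker) ↔
      ρ = 1 := by
  refine ⟨rho_eq_one_of_hUρ_of_edgeless c ρ baseAct P hP hH L hL, fun h a _ => ?_⟩
  rw [h, MonoidHom.mem_ker, MonoidHom.one_apply]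

end ProfiniteSemiGraph

namespace ProfiniteSemiGraph.GaloisLevelData

open CategoryTheory Topology

universe u

variable {𝒢 : ProfiniteSemiGraph.{u}} (D : GaloisLevelData 𝒢) (h𝒢 : 𝒢.IsCountable)
  (T : ∀ w : 𝒢.graph.Vertex, D.PointSeq h𝒢 w) (R : SemiGraph.RefBranches 𝒢.graph)

/-- **At one-vertex edgeless `𝒢` the vertex group of the coset-tower presentation is ALL of
`π₁^temp(𝒢)`**: `H_w = range (decompHom)` is closed (continuous image of the compact `Π_w`) and — there
being no branch elements — a closed subgroup containing the `H_w`'s is everything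
(`eq_top_of_isClosed`).  Hence the hypothesis `hH` of the obstruction theorems above is met by
`D.piPresentation h𝒢 T R` for EVERY Galois level data `D` (canonical or characteristic tower).
[cite: MochizukiSemiAnbd2006, Prop 3.6 (i) p.38] -/
theorem piPresentation_H_eq_top_of_edgeless [Subsingleton 𝒢.graph.Vertex] [IsEmpty 𝒢.graph.Edge]
    (w : 𝒢.graph.Vertex) : (D.piPresentation h𝒢 T R).H w = ⊤ := by
  haveI : IsEmpty 𝒢.graph.Branch := ⟨fun b => isEmptyElim (𝒢.graph.edgeOf b)⟩
  haveI := D.t2Space_temperedPi h𝒢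
  refine D.eq_top_of_isClosed h𝒢 T R _ (fun w' => ?_) (fun b => isEmptyElim b) ?_
  · rw [Subsingleton.elim w' w]
  · rw [D.piPresentation_H h𝒢 T R w, MonoidHom.coe_range, ← Set.image_univ]
    exact (isCompact_univ.image (T w).continuous_decompHom).isClosed

end ProfiniteSemiGraph.GaloisLevelData

end Literature.AnabelianGeometry.SemiGraphs
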